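import Literature.Analysis.Matrix.KyFanMaximumPrinciple

/-!
# The STANDARD isotropic Eliashberg equation is a compression of the anisotropic one

`EliashbergIsotropicCompression` (p465971) proved that the Fermi-surface average of a linearised
anisotropic Eliashberg kernel — the compression by the frame `u_n = (√w_k δ_{mn})` — cannot raise an
eigenvalue, and flagged as a RESIDUAL that the STANDARD isotropic equation (Fermi-surface-averaged
`α²F` inside BOTH the mass renormalisation `Z` and the gap kernel, one `μ*`) is that compression only
when the symmetrising weights are channel-independent. This file removes the residual: the standard
isotropic kernel IS a compression of the anisotropic kernel — by a DIFFERENT orthonormal frame, whose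
weights carry the channel mass renormalisations.

Set-up (multiband / `k`-resolved linearised equations on `N` Matsubara frequencies, `M` channels
with weights `w_k = r_k²`, `Σ_k r_k² = 1`, constant Coulomb pseudopotential `μ`): with the symmetrising
weights `σ_{k,n} = (πT/(ω_n Z_{k,n}))^{1/2}` the anisotropic kernel is
`K_{(k,n),(k',n')} = r_k r_{k'} (V_{kk'}(n,n') − μ) σ_{k,n} σ_{k',n'}`
(`V_{kk'}(n,n') = λ_{kk'}(n−n') + λ_{kk'}(n+n'+1)` divided by `w_{k'}`, symmetric), and the STANDARD
isotropic kernel is `S_{nn'} = (λ_iso(n,n') − μ) σ̄_n σ̄_{n'}` with `λ_iso = Σ_{kk'} w_k w_{k'} V_{kk'}`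
and `σ̄_n = (πT/(ω_n Z_iso,n))^{1/2}`, where — because `λ_iso(ν) = Σ_k w_k λ_k(ν)` — the isotropic mass
renormalisation is the weight average, `ω_n Z_iso,n = Σ_k w_k ω_n Z_{k,n}`, i.e.
`σ̄_n² · Σ_k w_k/σ_{k,n}² = 1`. Under exactly this identity the vectors
`f_n = (r_k σ̄_n/σ_{k,n} · δ_{mn})_{(k,m)}` are ORTHONORMAL and `f_nᵀ K f_{n'} = S_{nn'}`.
Hence (Poincaré separation, Horn–Johnson Cor. 4.3.37): every sorted eigenvalue of `S` is at most the
corresponding one of `K`; the standard isotropic linearised-Eliashberg `T_c` is a LOWER bound of the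
anisotropic one for ANY channel-dependent `Z` — the lower edge `1.00` of an anisotropy box on a
standard isotropic `T_c` band is a theorem, not an empirical statement.

Proved here:
* `anisoKernel`, `stdIsoKernel` — the two kernels as plain functions of the data `(r, σ, σ̄, V, μ)`;
* `zFrame`, `zFrame_orthonormal` — the `Z`-weighted averaging frame and its orthonormality under
  `σ̄_n² Σ_k r_k²/σ_{k,n}² = 1`;
* `zFrame_compression_eq_stdIsoKernel` — `f_nᵀ K f_{n'} = S_{nn'}` (needs `Σ r² = 1`, `σ ≠ 0`);
* `eigenvalues₀_zCompression_le`, `eigenvalues₀_stdIsoKernel_le` — `λ_j↓(S) ≤ λ_j↓(K)` for every `j`;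
* `sSup_superlevel_stdIso_le` — threshold form: `T_c^{iso,standard} ≤ T_c^{aniso}` (stated for the
  compression matrix, which equals `S` by `zCompression_eq_stdIsoKernel`).

## References
* [HornJohnson2013] R. A. Horn, C. R. Johnson, *Matrix Analysis*, 2nd ed., CUP 2013 — Cor. 4.3.37
  (Poincaré separation), eq. (4.3.38).
* [AllenDynes1975] P. B. Allen, R. C. Dynes, Phys. Rev. B 12 (1975) 905 — Eqs. (9)–(12)
  (isotropic imaginary-axis equations; `Z` and the gap kernel from the same `α²F`).
-/

noncomputable section

open scoped Matrix

namespace Literature.MathematicalPhysics.QuantumManyBody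

open Finset _root_.Matrix Literature.Analysis.Matrix

variable {M N : Type*} [Fintype M] [Fintype N] [DecidableEq M] [DecidableEq N]

/-! ### The two kernels -/

/-- **Anisotropic (multichannel) symmetrised linearised Eliashberg kernel** on `M × N`:
`K_{(k,n),(k',n')} = r_k r_{k'} (V_{kk'}(n,n') − μ) σ_{k,n} σ_{k',n'}` with `r_k = √w_k`,
`σ_{k,n} = (πT/(ω_n Z_{k,n}))^{1/2}`, `V` the (symmetric) pairing interaction per unit weight and `μ`
the Fermi-surface-constant Coulomb pseudopotential. [cite: AllenDynes1975, Eqs. (9)–(12)] -/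
def anisoKernel (r : M → ℝ) (σ : M → N → ℝ) (V : M → M → N → N → ℝ) (μ : ℝ) :
    Matrix (M × N) (M × N) ℝ :=
  Matrix.of fun x y => r x.1 * r y.1 * (V x.1 y.1 x.2 y.2 - μ) * σ x.1 x.2 * σ y.1 y.2

/-- **Standard isotropic symmetrised kernel** on `N`:
`S_{nn'} = (Σ_{kk'} r_k² r_{k'}² V_{kk'}(n,n') − μ) σ̄_n σ̄_{n'}`, `σ̄_n = (πT/(ω_n Z_iso,n))^{1/2}` —
Fermi-surface-averaged coupling in the numerator AND the averaged mass renormalisation.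
[cite: AllenDynes1975, Eqs. (9)–(12)] -/
def stdIsoKernel (r : M → ℝ) (σbar : N → ℝ) (V : M → M → N → N → ℝ) (μ : ℝ) : Matrix N N ℝ :=
  Matrix.of fun a b => ((∑ k, ∑ k', r k ^ 2 * r k' ^ 2 * V k k' a b) - μ) * σbar a * σbar b

/-! ### The `Z`-weighted averaging frame -/

/-- The `Z`-weighted averaging frame: for each Matsubara index `n` the vector on `M × N` equal to
`r_k σ̄_n / σ_{k,n}` in channel `k` at frequency `n`, zero elsewhere. [cite: HornJohnson2013, Cor. 4.3.37] -/
def zFrame (r : M → ℝ) (σ : M → N → ℝ) (σbar : N → ℝ) (n : N) : M × N → ℝ :=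
  fun p => if p.2 = n then r p.1 * σbar n / σ p.1 n else 0

omit [DecidableEq M] in
/-- **Orthonormality of the `Z`-weighted frame** under the averaged-`Z` identity
`σ̄_n² · Σ_k r_k²/σ_{k,n}² = 1` (i.e. `ω_n Z_iso,n = Σ_k w_k ω_n Z_{k,n}`).
[cite: HornJohnson2013, Cor. 4.3.37] -/
theorem zFrame_orthonormal (r : M → ℝ) (σ : M → N → ℝ) (σbar : N → ℝ)
    (hZ : ∀ n, σbar n ^ 2 * ∑ k, r k ^ 2 / σ k n ^ 2 = 1) (a b : N) :
    zFrame r σ σbar a ⬝ᵥ zFrame r σ σbar b = if a = b then (1 : ℝ) else 0 := by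
  unfold zFrame dotProduct
  rw [Fintype.sum_prod_type]
  by_cases hab : a = b
  · subst hab
    rw [if_pos rfl, ← hZ a, Finset.mul_sum]
    refine Finset.sum_congr rfl fun k _ => ?_
    rw [Finset.sum_eq_single a]
    · simp only [ite_true]
      rw [div_eq_mul_inv]; ring
    · intro m _ hm; simp only [if_neg hm, zero_mul]
    · intro h; exact absurd (Finset.mem_univ a) h
  · rw [if_neg hab]
    refine Finset.sum_eq_zero fun k _ => Finset.sum_eq_zero fun m _ => ?_
    by_cases hma : m = a
    · subst hma; simp only [ite_true, if_neg hab, mul_zero]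
    · simp only [if_neg hma, zero_mul]

/-! ### The standard isotropic kernel is the compression by the `Z`-weighted frame -/

omit [DecidableEq M] in
/-- **`f_aᵀ K f_b = S_{ab}`**: the standard isotropic kernel is the compression of the anisotropic
kernel by the `Z`-weighted frame (needs `Σ_k r_k² = 1` and `σ_{k,n} ≠ 0`).
[cite: HornJohnson2013, Cor. 4.3.37] -/
theorem zFrame_compression_eq_stdIsoKernel (r : M → ℝ) {σ : M → N → ℝ} (hσ : ∀ k n, σ k n ≠ 0)
    (σbar : N → ℝ) (V : M → M → N → N → ℝ) (μ : ℝ) (hr : ∑ k, r k ^ 2 = 1) (a b : N) :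
    zFrame r σ σbar a ⬝ᵥ anisoKernel r σ V μ *ᵥ zFrame r σ σbar b = stdIsoKernel r σbar V μ a b := by
  -- expand the compression entry into the double channel sum
  have hexp : zFrame r σ σbar a ⬝ᵥ anisoKernel r σ V μ *ᵥ zFrame r σ σbar b =
      ∑ k, ∑ k', (r k * σbar a / σ k a) * (r k * r k' * (V k k' a b - μ) * σ k a * σ k' b) *
        (r k' * σbar b / σ k' b) := by
    unfold zFrame anisoKernel
    rw [dotProduct, Fintype.sum_prod_type]
    refine Finset.sum_congr rfl fun k _ => ?_
    rw [Finset.sum_eq_single a]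
    · simp only [ite_true, mulVec, dotProduct, Matrix.of_apply]
      rw [Fintype.sum_prod_type, Finset.mul_sum]
      refine Finset.sum_congr rfl fun k' _ => ?_
      rw [Finset.sum_eq_single b]
      · simp only [ite_true]; ring
      · intro m _ hm; simp only [if_neg hm, mul_zero]
      · intro h; exact absurd (Finset.mem_univ b) h
    · intro m _ hm; simp only [if_neg hm, zero_mul]
    · intro h; exact absurd (Finset.mem_univ a) h
  rw [hexp, stdIsoKernel, Matrix.of_apply]
  -- each summand simplifies to r_k² r_k'² (V − μ) σ̄_a σ̄_b
  have hterm : ∀ k k', (r k * σbar a / σ k a) * (r k * r k' * (V k k' a b - μ) * σ k a * σ k' b) *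
      (r k' * σbar b / σ k' b) = r k ^ 2 * r k' ^ 2 * (V k k' a b - μ) * (σbar a * σbar b) := by
    intro k k'
    field_simp [hσ k a, hσ k' b]
    try ring
  simp_rw [hterm]
  -- Σ_kk' r²r'²(V − μ) = Σ r²r'² V − μ (Σ r²)(Σ r'²) = Σ r²r'² V − μ
  have hpt : ∀ k k', r k ^ 2 * r k' ^ 2 * (V k k' a b - μ) * (σbar a * σbar b) =
      (σbar a * σbar b) * (r k ^ 2 * r k' ^ 2 * V k k' a b) - (μ * (σbar a * σbar b)) * (r k ^ 2 * r k' ^ 2) := by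
    intro k k'; ring
  simp_rw [hpt, Finset.sum_sub_distrib, ← Finset.mul_sum]
  rw [← Finset.sum_mul, hr]
  ring

/-- The matrix of compression entries. [cite: HornJohnson2013, Cor. 4.3.37] -/
def zCompression (r : M → ℝ) (σ : M → N → ℝ) (σbar : N → ℝ) (V : M → M → N → N → ℝ) (μ : ℝ) :
    Matrix N N ℝ :=
  Matrix.of fun a b => zFrame r σ σbar a ⬝ᵥ anisoKernel r σ V μ *ᵥ zFrame r σ σbar b

omit [DecidableEq M] in
/-- The compression matrix equals the standard isotropic kernel. [cite: HornJohnson2013, Cor. 4.3.37] -/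
theorem zCompression_eq_stdIsoKernel (r : M → ℝ) {σ : M → N → ℝ} (hσ : ∀ k n, σ k n ≠ 0)
    (σbar : N → ℝ) (V : M → M → N → N → ℝ) (μ : ℝ) (hr : ∑ k, r k ^ 2 = 1) :
    zCompression r σ σbar V μ = stdIsoKernel r σbar V μ := by
  ext a b
  rw [zCompression, Matrix.of_apply, zFrame_compression_eq_stdIsoKernel r hσ σbar V μ hr]

omit [DecidableEq M] in
/-- The compression of a symmetric kernel is symmetric. [cite: HornJohnson2013, Cor. 4.3.37] -/
theorem isHermitian_zCompression {r : M → ℝ} {σ : M → N → ℝ} {V : M → M → N → N → ℝ} {μ : ℝ}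
    (hK : (anisoKernel r σ V μ).IsHermitian) (σbar : N → ℝ) :
    (zCompression r σ σbar V μ).IsHermitian := by
  have hKt : (anisoKernel r σ V μ)ᵀ = anisoKernel r σ V μ := by
    have := hK; unfold Matrix.IsHermitian at this
    rwa [conjTranspose_eq_transpose_of_trivial] at this
  unfold Matrix.IsHermitian zCompression
  rw [conjTranspose_eq_transpose_of_trivial]
  ext a b
  rw [transpose_apply, Matrix.of_apply, Matrix.of_apply, dotProduct_mulVec, ← mulVec_transpose,
    hKt, dotProduct_comm]

/-! ### Poincaré separation: the standard isotropic `T_c` is a lower bound of the anisotropic one -/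

/-- **Every sorted eigenvalue of the standard isotropic kernel is at most the corresponding eigenvalue
of the anisotropic kernel** — for ANY channel-dependent mass renormalisation, provided the isotropic
`Z` is the weight average (`σ̄_n² Σ_k r_k²/σ_{k,n}² = 1`), `Σ_k r_k² = 1`, `σ ≠ 0`, and the anisotropic
kernel is symmetric. [cite: HornJohnson2013, Cor. 4.3.37, eq. (4.3.38)] -/
theorem eigenvalues₀_zCompression_le {r : M → ℝ} {σ : M → N → ℝ} {V : M → M → N → N → ℝ} {μ : ℝ}
    (hK : (anisoKernel r σ V μ).IsHermitian) {σbar : N → ℝ}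
    (hZ : ∀ n, σbar n ^ 2 * ∑ k, r k ^ 2 / σ k n ^ 2 = 1) (j : Fin (Fintype.card N)) :
    (isHermitian_zCompression hK σbar).eigenvalues₀ j ≤
      hK.eigenvalues₀ (Fin.castLE
        (KyFan.card_le_of_orthonormal (zFrame r σ σbar) (zFrame_orthonormal r σ σbar hZ)) j) :=
  KyFan.eigenvalues₀_compression_le hK (zFrame r σ σbar) (zFrame_orthonormal r σ σbar hZ)
    (isHermitian_zCompression hK σbar) j

/-- The same inequality stated for the standard isotropic kernel itself (any symmetry proof `hS`):
`λ_j↓(S) ≤ λ_j↓(K)` — needs `Σ_k r_k² = 1` and `σ ≠ 0` for the identification `S = f Kᵀ f`.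
[cite: HornJohnson2013, Cor. 4.3.37, eq. (4.3.38)] -/
theorem eigenvalues₀_stdIsoKernel_le {r : M → ℝ} {σ : M → N → ℝ} {V : M → M → N → N → ℝ} {μ : ℝ}
    (hK : (anisoKernel r σ V μ).IsHermitian) (hσ : ∀ k n, σ k n ≠ 0) {σbar : N → ℝ}
    (hZ : ∀ n, σbar n ^ 2 * ∑ k, r k ^ 2 / σ k n ^ 2 = 1) (hr : ∑ k, r k ^ 2 = 1)
    (hS : (stdIsoKernel r σbar V μ).IsHermitian) (j : Fin (Fintype.card N)) :
    hS.eigenvalues₀ j ≤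
      hK.eigenvalues₀ (Fin.castLE
        (KyFan.card_le_of_orthonormal (zFrame r σ σbar) (zFrame_orthonormal r σ σbar hZ)) j) := by
  have h := eigenvalues₀_zCompression_le hK hZ j
  have heq : (isHermitian_zCompression hK σbar).eigenvalues₀ = hS.eigenvalues₀ := by
    congr 1
    exact zCompression_eq_stdIsoKernel r hσ σbar V μ hr
  rw [heq] at h
  exact h

/-- Order lemma: a pointwise-smaller function has the smaller super-level-`1` supremum over `T > 0`.
[folklore] -/
private theorem sSup_superlevel_mono' {f g : ℝ → ℝ} (h : ∀ T, f T ≤ g T)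
    (hbdd : BddAbove {T : ℝ | 0 < T ∧ 1 ≤ g T}) :
    sSup {T : ℝ | 0 < T ∧ 1 ≤ f T} ≤ sSup {T : ℝ | 0 < T ∧ 1 ≤ g T} := by
  have hsub : {T : ℝ | 0 < T ∧ 1 ≤ f T} ⊆ {T : ℝ | 0 < T ∧ 1 ≤ g T} :=
    fun T ⟨hT, h1⟩ => ⟨hT, h1.trans (h T)⟩
  by_cases hne : ({T : ℝ | 0 < T ∧ 1 ≤ f T} : Set ℝ).Nonempty
  · exact csSup_le_csSup hbdd hne hsub
  · rw [Set.not_nonempty_iff_eq_empty] at hne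
    rw [hne, Real.sSup_empty]
    exact Real.sSup_nonneg fun T hT => hT.1.le

/-- **The standard isotropic `T_c` is a LOWER bound of the anisotropic `T_c` (threshold form).**
With temperature-dependent data `(σ(T), σ̄(T), V(T))` satisfying the averaged-`Z` identity and
`Σ r² = 1` at every `T`, and `ρ_std(T)`, `ρ(T)` the top eigenvalues of the standard isotropic and
the anisotropic kernels, `sup {T > 0 | 1 ≤ ρ_std} ≤ sup {T > 0 | 1 ≤ ρ}` (given `BddAbove` of the
latter): the `1.00` lower edge of an anisotropy box applied to a STANDARD isotropic Eliashberg `T_c`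
band. [cite: HornJohnson2013, Cor. 4.3.37, eq. (4.3.38)] -/
theorem sSup_superlevel_stdIso_le {r : M → ℝ} {σ : ℝ → M → N → ℝ} {V : ℝ → M → M → N → N → ℝ}
    {μ : ℝ} (hK : ∀ T, (anisoKernel r (σ T) (V T) μ).IsHermitian)
    {σbar : ℝ → N → ℝ} (hZ : ∀ T n, σbar T n ^ 2 * ∑ k, r k ^ 2 / σ T k n ^ 2 = 1)
    (hN : 1 ≤ Fintype.card N)
    (hbdd : BddAbove {T : ℝ | 0 < T ∧ 1 ≤ (hK T).eigenvalues₀ (Fin.castLE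
      ((KyFan.card_le_of_orthonormal (zFrame r (σ T) (σbar T))
        (zFrame_orthonormal r (σ T) (σbar T) (hZ T))).trans' hN) 0)}) :
    sSup {T : ℝ | 0 < T ∧ 1 ≤ (isHermitian_zCompression (hK T) (σbar T)).eigenvalues₀
        (Fin.castLE hN 0)} ≤
      sSup {T : ℝ | 0 < T ∧ 1 ≤ (hK T).eigenvalues₀ (Fin.castLE
        ((KyFan.card_le_of_orthonormal (zFrame r (σ T) (σbar T))
          (zFrame_orthonormal r (σ T) (σbar T) (hZ T))).trans' hN) 0)} := by
  refine sSup_superlevel_mono' (fun T => ?_) hbdd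
  have h := eigenvalues₀_zCompression_le (hK T) (hZ T) (Fin.castLE hN 0)
  convert h using 2
  exact Fin.ext (by simp)

end Literature.MathematicalPhysics.QuantumManyBody

end
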